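import Summits.CriticalPhenomena.PercolationContinuityZ3.Theorems.Transplant.SkelFrmBParamsClearF
import Summits.CriticalPhenomena.PercolationContinuityZ3.Theorems.Transplant.SkelFrmBParamsFramesF2
import Summits.CriticalPhenomena.PercolationContinuityZ3.Theorems.Transplant.SkelPhiFaceClearFloorsY
import Summits.CriticalPhenomena.PercolationContinuityZ3.Theorems.Transplant.PlanarSkeletonFrmDefs
import Summits.CriticalPhenomena.PercolationContinuityZ3.Theorems.Transplant.SkelPhiStepIDataNS
import HarnessLib
/-!
(F) VALUE LAYER, N2 twin (hp-8 g42, 2026-08-23; F-DISCHARGE-MAP-N2 G18 y′ clearances): `port_frm.py` text of N1 `SkelNegBParamsFaceFloorsClrYF` (p1-g13) over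
`SkelFrmBParamsClearF` / `SkelFrmBParamsFramesF2` (hp-8 g42); kit level radius re-pointed `RA′ ↦ KS0.R'0`; statements/proofs otherwise verbatim
(`hclrLo_YFs/hclrHi_YFs`, `hclrLo_YFd/hclrHi_YFd`, `hclrLo_YFt/hclrHi_YFt` in p1's served shape over `Skelφ.hclrP_of_clearF/hclrM_of_clearF`).
NON-VACUITY: arithmetic under the bridge clearance `clearF` and the count/level floors `N+1 ≤ c`, `R′ ≤ R'0`.
builds on p205010 (kernel theorem, internal audit signed; external expert review pending); nothing here is a claim about the open node `SamePDropOfSkeletonFrm₁`.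
N1 HEADER (kept for the reader):
# N1 params, M3 group G-clr (y′-face), AT THE ORIGINS OF RECORD — the fields `hclrLo`/`hclrHi` of `Skelφ.FloorsY2` (SkelPhiFaceNumsYP2 :94–:96) for the
# three landing origins of the wide bridge `yLFs σ σh` (case same, FramesF p3xx), `yLFd`, `yLFt` (transposed cases, FramesF2), at `pr.vα := v_L`,
# `R's := RA′ mk`, `Mz := M_u`, along count `Nr` with `Nr + 1 ≤ c` (the bridge count), hop side `σh` with the (L-F1) convention as a hypothesis
# (`σ·σh = 1 → 0 ≤ v_L`, `σ·σh = −1 → v_L ≤ 0`; `σh := σ·sgn⁺ v_L` satisfies both): each is p1-g13's `Skelφ.hclrP_of_clearF`/`hclrM_of_clearF` (p314730)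
# at the origin identity `yLF?_zero` and stmt's v-free floor `KS.clearF_s/d/t` (p314880) — the composition the G-CLR memo calls 'served', now BY NAME
(p1-g14, 2026-08-22; complements the generic `hclrLo_YA_gen/hclrHi_YA_gen` of FloorsClrYA p322863 for an integrator who instantiates `yLF′ := yLFs/d/t`).
builds on p205010 (kernel theorem, internal audit signed; external expert review pending) — nothing in this file uses p205010; NOTHING is claimed about the node
`SamePDropOfSkeletonNeg₁` (OPEN); integer arithmetic only.
Lane `prim-bschramm-*`, seat `prim-bschramm-p1` (gen 14); helper file (`--supports stmt-CriticalPhenomena-4575 --as helper`); slot-ledger ζ′ v1/v2.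
* **`hclrLo_YFs`/`hclrHi_YFs`** (case same), **`hclrLo_YFd`/`hclrHi_YFd`** (steep transposed: `ℓBF < 2|hBF|`), **`hclrLo_YFt`/`hclrHi_YFt`** (flat transposed).
[cite: KozmaNitzan2024, §4 Lemma 11 (pp. 22–23)] [cite: MartineauTassion2017, §4.3 Lemma 4.2]
-/

noncomputable section

open scoped Classical

namespace Summit.CriticalPhenomena.PercolationContinuityZ3.Theorems.Transplant

namespace PlanarSkeletonFrm

namespace NegB

open Literature.Probability.Percolation Literature.Probability.LatticeModels SimpleGraph
open Literature.Probability.Percolation.KozmaNitzan.Cells (oth sgOf sgOf_sign)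
open SkelConc (Consts)
open Skelφ (yBoxLoT yBoxHiT)
open Skelφ.StepI (DataN)
open Neg

namespace KS

section ClrYF

/-- **`hclrLo`, case same**: at `yL := yLFs σ σh` (`σ := sgOf du`), on the hop side `σ·σh = 1` (so `0 ≤ v_L`) every region `k ≤ Nr` of the along y′-run
has its transverse floor above `M_u`, given `Nr + 1 ≤ c`. [cite: KozmaNitzan2024, §4 Lemma 11 (p. 22)] -/
theorem hclrLo_YFs (κ : Consts) {V : Type} [DecidableEq V] [Countable V] {G : SimpleGraph V} [G.LocallyFinite] (Φ : PlanarSkeletonFrm G) (t : V) (p : unitInterval) (D : Skelφ.StepI.DataNS V) (c : ℕ) (mk : ℕ) (g : ℕ) (f : ℕ) (hN : EqNumL κ Φ t p D g f) (du : MDir) {σh : ℤ} (hhop : sgOf du * σh = 1 → 0 ≤ vL κ Φ t p D g f) {Nr : ℕ} (hc : Nr + 1 ≤ c) :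
    sgOf du * σh = 1 → ∀ k ≤ Nr, ((Mu D : ℕ) : ℤ) < yBoxLoT (nL κ Φ t p D g f) (vL κ Φ t p D g f) (KS0.R'0 κ Φ t p D mk) k +
      sgOf du * (yLFs κ Φ t p D c mk g f (sgOf du) σh) 0 := by
  intro h
  have ha := yLFs_zero κ Φ t p D c mk g f (sgOf_sign du) σh
  rw [h, one_mul] at ha
  exact Skelφ.hclrP_of_clearF hN.v_le (hhop h) (KS0.R'0 κ Φ t p D mk) Nr (clo := (nL κ Φ t p D g f : ℤ) + nBF κ Φ t p D c mk - KS0.R'0 κ Φ t p D mk)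
    (by linarith [ha]) (clearF_s κ Φ t p D c mk (nL κ Φ t p D g f) hc le_rfl)

/-- **`hclrHi`, case same**: on the opposite hop side `σ·σh = −1` (so `v_L ≤ 0`) every region's transverse ceiling stays below `−M_u`.
[cite: KozmaNitzan2024, §4 Lemma 11 (p. 22)] -/
theorem hclrHi_YFs (κ : Consts) {V : Type} [DecidableEq V] [Countable V] {G : SimpleGraph V} [G.LocallyFinite] (Φ : PlanarSkeletonFrm G) (t : V) (p : unitInterval) (D : Skelφ.StepI.DataNS V) (c : ℕ) (mk : ℕ) (g : ℕ) (f : ℕ) (hN : EqNumL κ Φ t p D g f) (du : MDir) {σh : ℤ} (hhop : sgOf du * σh = -1 → vL κ Φ t p D g f ≤ 0) {Nr : ℕ} (hc : Nr + 1 ≤ c) :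
    sgOf du * σh = -1 → ∀ k ≤ Nr, yBoxHiT (nL κ Φ t p D g f) (vL κ Φ t p D g f) (KS0.R'0 κ Φ t p D mk) k +
      sgOf du * (yLFs κ Φ t p D c mk g f (sgOf du) σh) 0 < -((Mu D : ℕ) : ℤ) := by
  intro h
  have ha := yLFs_zero κ Φ t p D c mk g f (sgOf_sign du) σh
  rw [h] at ha
  exact Skelφ.hclrM_of_clearF hN.v_le (hhop h) (KS0.R'0 κ Φ t p D mk) Nr (clo := (nL κ Φ t p D g f : ℤ) + nBF κ Φ t p D c mk - KS0.R'0 κ Φ t p D mk)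
    (by linarith [ha]) (clearF_s κ Φ t p D c mk (nL κ Φ t p D g f) hc le_rfl)

/-- **`hclrLo`, steep transposed case** (`yL := yLFd σ σh`, `ℓBF < 2|hBF|`, `2·bF + 27 ≤ ℓBF` = `ℓBF_ge`). [cite: KozmaNitzan2024, §4 Lemma 11 (p. 22)] -/
theorem hclrLo_YFd (κ : Consts) {V : Type} [DecidableEq V] [Countable V] {G : SimpleGraph V} [G.LocallyFinite] (Φ : PlanarSkeletonFrm G) (t : V) (p : unitInterval) (D : Skelφ.StepI.DataNS V) (c : ℕ) (mk : ℕ) (g : ℕ) (f : ℕ) (hN : EqNumL κ Φ t p D g f) (du : MDir) {σh : ℤ} (hhop : sgOf du * σh = 1 → 0 ≤ vL κ Φ t p D g f) {Nr : ℕ} (hc : Nr + 1 ≤ c)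
    (hside : ℓBF κ Φ t p D c mk < 2 * (hBF κ Φ t p D c mk).natAbs) (hℓb : 2 * bF κ Φ t p D c mk + 27 ≤ ℓBF κ Φ t p D c mk) :
    sgOf du * σh = 1 → ∀ k ≤ Nr, ((Mu D : ℕ) : ℤ) < yBoxLoT (nL κ Φ t p D g f) (vL κ Φ t p D g f) (KS0.R'0 κ Φ t p D mk) k +
      sgOf du * (yLFd κ Φ t p D c mk g f (sgOf du) σh) 0 := by
  intro h
  have ha := yLFd_zero κ Φ t p D c mk g f (sgOf_sign du) σh
  rw [h, one_mul] at ha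
  exact Skelφ.hclrP_of_clearF hN.v_le (hhop h) (KS0.R'0 κ Φ t p D mk) Nr (clo := (nL κ Φ t p D g f : ℤ) - KS0.R'0 κ Φ t p D mk + |hBF κ Φ t p D c mk|)
    (by linarith [ha]) (clearF_d κ Φ t p D c mk (nL κ Φ t p D g f) hc le_rfl hside hℓb)

/-- **`hclrHi`, steep transposed case.** [cite: KozmaNitzan2024, §4 Lemma 11 (p. 22)] -/
theorem hclrHi_YFd (κ : Consts) {V : Type} [DecidableEq V] [Countable V] {G : SimpleGraph V} [G.LocallyFinite] (Φ : PlanarSkeletonFrm G) (t : V) (p : unitInterval) (D : Skelφ.StepI.DataNS V) (c : ℕ) (mk : ℕ) (g : ℕ) (f : ℕ) (hN : EqNumL κ Φ t p D g f) (du : MDir) {σh : ℤ} (hhop : sgOf du * σh = -1 → vL κ Φ t p D g f ≤ 0) {Nr : ℕ} (hc : Nr + 1 ≤ c)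
    (hside : ℓBF κ Φ t p D c mk < 2 * (hBF κ Φ t p D c mk).natAbs) (hℓb : 2 * bF κ Φ t p D c mk + 27 ≤ ℓBF κ Φ t p D c mk) :
    sgOf du * σh = -1 → ∀ k ≤ Nr, yBoxHiT (nL κ Φ t p D g f) (vL κ Φ t p D g f) (KS0.R'0 κ Φ t p D mk) k +
      sgOf du * (yLFd κ Φ t p D c mk g f (sgOf du) σh) 0 < -((Mu D : ℕ) : ℤ) := by
  intro h
  have ha := yLFd_zero κ Φ t p D c mk g f (sgOf_sign du) σh
  rw [h] at ha
  exact Skelφ.hclrM_of_clearF hN.v_le (hhop h) (KS0.R'0 κ Φ t p D mk) Nr (clo := (nL κ Φ t p D g f : ℤ) - KS0.R'0 κ Φ t p D mk + |hBF κ Φ t p D c mk|)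
    (by linarith [ha]) (clearF_d κ Φ t p D c mk (nL κ Φ t p D g f) hc le_rfl hside hℓb)

/-- **`hclrLo`, flat transposed case** (`yL := yLFt σ σh`, `2|hBF| ≤ ℓBF`, `2·bF + 27 ≤ ℓBF`). [cite: KozmaNitzan2024, §4 Lemma 11 (p. 22)] -/
theorem hclrLo_YFt (κ : Consts) {V : Type} [DecidableEq V] [Countable V] {G : SimpleGraph V} [G.LocallyFinite] (Φ : PlanarSkeletonFrm G) (t : V) (p : unitInterval) (D : Skelφ.StepI.DataNS V) (c : ℕ) (mk : ℕ) (g : ℕ) (f : ℕ) (hN : EqNumL κ Φ t p D g f) (du : MDir) {σh : ℤ} (hhop : sgOf du * σh = 1 → 0 ≤ vL κ Φ t p D g f) {Nr : ℕ} (hc : Nr + 1 ≤ c)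
    (htop : 2 * (hBF κ Φ t p D c mk).natAbs ≤ ℓBF κ Φ t p D c mk) (hℓb : 2 * bF κ Φ t p D c mk + 27 ≤ ℓBF κ Φ t p D c mk) :
    sgOf du * σh = 1 → ∀ k ≤ Nr, ((Mu D : ℕ) : ℤ) < yBoxLoT (nL κ Φ t p D g f) (vL κ Φ t p D g f) (KS0.R'0 κ Φ t p D mk) k +
      sgOf du * (yLFt κ Φ t p D c mk g f (sgOf du) σh) 0 := by
  intro h
  have ha := yLFt_zero κ Φ t p D c mk g f (sgOf_sign du) σh
  rw [h, one_mul] at ha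
  exact Skelφ.hclrP_of_clearF hN.v_le (hhop h) (KS0.R'0 κ Φ t p D mk) Nr
    (clo := (nL κ Φ t p D g f : ℤ) - KS0.R'0 κ Φ t p D mk + ((ℓBF κ Φ t p D c mk : ℤ) - |hBF κ Φ t p D c mk| - 11))
    (by linarith [ha]) (clearF_t κ Φ t p D c mk (nL κ Φ t p D g f) hc le_rfl htop hℓb)

/-- **`hclrHi`, flat transposed case.** [cite: KozmaNitzan2024, §4 Lemma 11 (p. 22)] -/
theorem hclrHi_YFt (κ : Consts) {V : Type} [DecidableEq V] [Countable V] {G : SimpleGraph V} [G.LocallyFinite] (Φ : PlanarSkeletonFrm G) (t : V) (p : unitInterval) (D : Skelφ.StepI.DataNS V) (c : ℕ) (mk : ℕ) (g : ℕ) (f : ℕ) (hN : EqNumL κ Φ t p D g f) (du : MDir) {σh : ℤ} (hhop : sgOf du * σh = -1 → vL κ Φ t p D g f ≤ 0) {Nr : ℕ} (hc : Nr + 1 ≤ c)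
    (htop : 2 * (hBF κ Φ t p D c mk).natAbs ≤ ℓBF κ Φ t p D c mk) (hℓb : 2 * bF κ Φ t p D c mk + 27 ≤ ℓBF κ Φ t p D c mk) :
    sgOf du * σh = -1 → ∀ k ≤ Nr, yBoxHiT (nL κ Φ t p D g f) (vL κ Φ t p D g f) (KS0.R'0 κ Φ t p D mk) k +
      sgOf du * (yLFt κ Φ t p D c mk g f (sgOf du) σh) 0 < -((Mu D : ℕ) : ℤ) := by
  intro h
  have ha := yLFt_zero κ Φ t p D c mk g f (sgOf_sign du) σh
  rw [h] at ha
  exact Skelφ.hclrM_of_clearF hN.v_le (hhop h) (KS0.R'0 κ Φ t p D mk) Nr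
    (clo := (nL κ Φ t p D g f : ℤ) - KS0.R'0 κ Φ t p D mk + ((ℓBF κ Φ t p D c mk : ℤ) - |hBF κ Φ t p D c mk| - 11))
    (by linarith [ha]) (clearF_t κ Φ t p D c mk (nL κ Φ t p D g f) hc le_rfl htop hℓb)

end ClrYF

end KS

end NegB

end PlanarSkeletonFrm

end Summit.CriticalPhenomena.PercolationContinuityZ3.Theorems.Transplant

end
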